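import Literature.MathematicalPhysics.QuantumLattice.ClusterPairBosonCouplings
import Literature.MathematicalPhysics.QuantumLattice.DuhamelTwoPoint
import Literature.MathematicalPhysics.QuantumLattice.PairFieldMomentum
import Literature.MathematicalPhysics.QuantumLattice.HubbardModelParticleHoleProofs
import HarnessLib

/-!
# The zero-temperature pair susceptibility of a finite torus in a canonical sector

Definition request `defn-torusPairSusceptibility` (route `HubbardSuperconductivity/TorusCooperLog`,
crux `CooperLogWindow`, item `stmt-HubbardSuperconductivity-2818`). Three layers, all for finite
matrices over `ℂ` ("operators are matrices", vectors `n → ℂ`, `⟨x, y⟩ = star x ⬝ᵥ y`):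

1. **Static susceptibility of a level** (generic `K : Matrix n n ℂ`, real energy `E`, transition
   vector `v`): `staticSusceptibility K E v = 2 Re ⟨v, S_K(E) v⟩`, where
   `S_K(E) = reducedResolvent K E = Σ_{λ ≠ E} (λ − E)⁻¹ P_λ` is Kato's reduced resolvent
   (`ClusterPairBosonCouplings.lean`; Kato 1966, I-§5.3 (5.26)–(5.32)). For Hermitian `K` with
   orthonormal eigenbasis `(u_m, λ_m)` this is the spectral sum
   `2 Σ_m |⟨u_m, v⟩|² / (λ_m − E)` with the terms `λ_m = E` omitted (`staticSusceptibility_eq_sum`;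
   Lean's `x / 0 = 0` is exactly the reduced-resolvent convention), and for an eigenvector
   `K ψ = E ψ` and a Hermitian perturbation direction `B` it is `−2 Re ⟨ψ, T̃⁽²⁾ ψ⟩` for Kato's
   second-order reduced operator `T̃⁽²⁾ = −P B S B P = secondOrderEffective K B E` of the family
   `K − h B` (`staticSusceptibility_mulVec_eq_secondOrderEffective`; Kato 1966, II-§2.2 (2.20),
   (2.33), (2.35)): for a normalised `ψ` spanning the `E`-eigenspace (simple eigenvalue) this is
   `−d²λ/dh²|_{h=0}` of the eigenvalue branch `λ(h)` of `K − h B` through `E` (Kato 1966, II-(2.33)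
   with `T⁽¹⁾ = −B`, `T⁽²⁾ = 0`, `m = 1`), in general the diagonal element at `ψ` of the
   second-order reduction in the `E`-eigenspace.
2. **Canonical bookkeeping** on the Hubbard Fock space `Fock (Orb Λ)` (any finite `Λ`): the
   midpoint pair chemical potential `pairChemicalPotential H N = (E₀(N+2) − E₀(N−2))/4` and the pair
   excitation gap `pairGap H N = (E₀(N+2) + E₀(N−2) − 2E₀(N))/2 = E₀(N±2) − E₀(N) ∓ 2μ̄`,
   `E₀(M) = Matrix.minEnergyOn H (szSector M 0)` (Lin–Hirsch–Scalapino 1988, eq. (9) and the display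
   following it: with this `μ̄` the lowest intermediate states of the `(N−2)`- and `(N+2)`-particle
   sectors sit at the SAME excitation energy `Δ` above the `N`-particle ground state).
3. **The torus pair susceptibility** `torusPairSusceptibility H A N ψ` of a Hamiltonian `H` on the
   Fock space of the fermionic torus `FermionTorus 2 L`, a pair operator `A` (e.g.
   `pairField g L`, lowering the particle number by two), a particle number `N` and a sector state
   `ψ` (intended: `H` Hermitian commuting with `N̂` and `S^z`, `ψ` a normalised ground state of `H`
   in `szSector N 0`): `staticSusceptibility K E ((A + Aᴴ) ψ)` with `K = H − μ̄ N̂`,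
   `μ̄ = pairChemicalPotential H N`, `E = E₀(N) − μ̄ N` — i.e.
   `χ_A(ψ) = 2 Σ_m |⟨m, (A + Aᴴ) ψ⟩|² / (E^K_m − E^K_ψ)` over an orthonormal eigenbasis `m` of `K`,
   terms with `E^K_m = E^K_ψ` omitted (`torusPairSusceptibility_eq_sum`). When `H` conserves `N̂`
   and `S^z`, `ψ ∈ szSector N 0` and `A` lowers `N` by two at fixed `S^z`, the vector `(A + Aᴴ)ψ`
   lies in `szSector (N−2) 0 ⊕ szSector (N+2) 0`, which `K` preserves, so only eigenvectors of `K`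
   in these two sectors contribute and the denominators there are `(ε − E₀(N∓2)) + pairGap H N`
   (`ε` the `H`-eigenvalue of `m`), i.e. `χ_A(ψ) = 2 [Σ_{m ∈ (N+2)} |⟨m, Aᴴψ⟩|² / (E^K_m − E)
   + Σ_{m ∈ (N−2)} |⟨m, Aψ⟩|² / (E^K_m − E)]`: twice the sum of the zero-frequency, zero-temperature
   particle–particle and hole–hole pair propagators of the sector ground state,
   `∫₀^∞ (⟨ψ, A e^{−τ(K−E)} Aᴴ ψ⟩ + ⟨ψ, Aᴴ e^{−τ(K−E)} A ψ⟩) dτ` when `pairGap H N > 0` — the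
   `T = 0`, fixed-`N` counterpart of the pair-field susceptibility `P = ∫₀^β ⟨Δ(τ) Δ†(0)⟩ dτ` of
   Lin–Hirsch–Scalapino 1988, eq. (8) (whose midpoint chemical potential, eq. (9), is the `μ̄` used
   here), of White et al. 1989 and of Scalapino 1995, §4 (`P_d`). This identification is recorded
   informally; it is not a theorem of this file.

API: unfolding lemmas, `staticSusceptibility_smul` / `torusPairSusceptibility_smul` (phase and
normalisation bookkeeping, `χ(cψ) = ‖c‖² χ(ψ)`), nonnegativity when `v` only meets eigenvalues
`≥ E` (`staticSusceptibility_nonneg`, `torusPairSusceptibility_nonneg`), the functional calculus on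
an eigenvector (`Matrix.IsHermitian.cfc_mulVec_of_eigenvector`, whence `S ψ = 0`, `P ψ = ψ`), and
the ground-state form `torusPairSusceptibility_eq_of_isGroundStateInSector`
(`χ_A(ψ) = −2 Re ⟨ψ, secondOrderEffective K (A + Aᴴ) E ψ⟩` for every sector ground state `ψ`, with
no commutation hypothesis: `K ψ = E ψ` follows from `IsGroundStateInSector` alone).

NOT here (deliberately): the free (`U = 0`, closed-shell) evaluation of `χ` as an explicit Cooper
sum over torus momenta (a Wick computation; it belongs with the crux as a `--supports` lemma), and
Kato's analytic statement that `χ` is the second derivative of an eigenvalue branch (Kato 1966,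
II-§2.2–2.3; only the algebraic coefficient `T̃⁽²⁾` is used, as in `ClusterPairBosonCouplings`).
No named facts are introduced.

## Mathlib / tree search

Mathlib: `cfc` for Hermitian matrices (`Matrix.IsHermitian.cfc_eq`), `eigenvectorUnitary`,
`eigenvectorBasis`, `eigenvalues`, `Matrix.isHermitian_add_transpose_self` (`A + Aᴴ`); no reduced
resolvent, level-shift or susceptibility vocabulary (`rg -i "susceptib|reduced resolvent"` in
Mathlib: nothing). Tree (`lean search`): `reducedResolvent`, `eigenProj`, `secondOrderEffective`
and Kato's identities (`ClusterPairBosonCouplings`); `Matrix.IsHermitian.cfc_eq_conj_diagonal`,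
`star_mul_self_mul_eq_diagonal` (`DuhamelTwoPoint`); `szSector`, `IsGroundStateInSector`,
`FermionTorus` (`HubbardModel`); `totalNumber_isHermitian` (`PairFieldMomentum`),
`totalNumber_mulVec_of_isNParticle` (`HubbardModelParticleHoleProofs`); `pairField`
(`PairCorrelations`). The only susceptibilities in the topic were thermal / classical
(`KohnLuttinger.channelInf`, `XYOrder`, `LatticeScalarField`); nothing at `T = 0` in a sector.

## Design notes

* The window `szSector (N−2) 0 ⊕ szSector (N+2) 0` of the informal request is NOT imposed by a
  projection: `staticSusceptibility` is taken on the whole Fock space. Under the intended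
  hypotheses (`H` conserves `N̂` and `S^z`, `ψ ∈ szSector N 0`, `[N̂, A] = −2A`, `[S^z, A] = 0`, cf.
  `totalNumber_commutator_pairFieldAt`, `spinZ_commute_pairFieldAt`) the transition vector
  `(A + Aᴴ)ψ` already lies in the window and `K` preserves it, so the two agree; without them the
  present definition is still a number with the stated spectral meaning. This keeps the object a
  plain functional calculus of `K` (no transport to `EuclideanSpace`, no compression).
* `E = E₀(N) − μ̄ N` uses the sector energy `Matrix.minEnergyOn H (szSector N 0)`, not `⟨ψ, Kψ⟩`;
  for a sector ground state the two coincide (`pairShifted_mulVec_of_isGroundStateInSector`).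
* `N − 2` is truncated subtraction; for `N < 2` the `(N−2)`-sector data are junk (the intended use
  has `N` even and `≥ 2`). `Matrix.minEnergyOn` has junk value `0` on an empty sector.
* Values in `ℝ` (not `ℝ≥0∞`): a closing pair gap does not produce an infinity, the corresponding
  terms are omitted (reduced resolvent), exactly as in the informal definition.

## Sources

T. Kato, *Perturbation theory for linear operators* (1966), I-§5.3 (5.26)–(5.32) (reduced
resolvent), II-§2.2 (2.20), (2.33), Remark 2.2 (2.35) (second-order coefficient as a spectral sum)
[Kato1966]; H. Q. Lin, J. E. Hirsch, D. J. Scalapino, *Pairing in the two-dimensional Hubbard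
model: an exact diagonalization study*, PRB **37** (1988) 7359, §II eq. (4)–(9) (canonical pair
susceptibility, midpoint chemical potential `μ = ¼[E₀(N_e+2) − E₀(N_e−2)]`, gap `Δ`)
[LinHirschScalapino1988]; S. R. White et al., PRB **40** (1989) 506 (pair-field susceptibilities of
the 2D Hubbard model by QMC) [WhiteEtAl1989]; D. J. Scalapino, Phys. Rep. **250** (1995) 329, §4
(`P_d`) [Scalapino1995].
-/

noncomputable section

namespace Literature.MathematicalPhysics.QuantumLattice

open Matrix

/-! ### The static susceptibility of a level of a Hermitian matrix -/

section Static

variable {n : Type*} [Fintype n] [DecidableEq n]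

/-- The **static (zero-temperature) susceptibility** of the level `E` of the matrix `K` in the
transition direction `v`: `χ_K(E; v) = 2 Re ⟨v, S_K(E) v⟩` with `S_K(E) = reducedResolvent K E`
Kato's reduced resolvent (`(K − E)⁻¹` off the `E`-eigenspace, `0` on it). For Hermitian `K` this is
`2 Σ_m |⟨u_m, v⟩|² / (λ_m − E)` over an orthonormal eigenbasis, terms with `λ_m = E` omitted
(`staticSusceptibility_eq_sum`), i.e. `−2 λ̂⁽²⁾` for the second-order coefficient `λ̂⁽²⁾` of the
eigenvalue of `K − h B` issuing from a simple eigenvalue `E` with normalised eigenvector `ψ`,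
`v = B ψ` (Kato 1966, II-§2.2 (2.33): `λ̂⁽²⁾ = tr [T⁽²⁾P − T⁽¹⁾ S T⁽¹⁾ P]` with `T⁽¹⁾ = −B`,
`T⁽²⁾ = 0`, `P = |ψ⟩⟨ψ|`).
[cite: Kato1966, II-§2.2 (2.33), (2.35)] -/
def staticSusceptibility (K : Matrix n n ℂ) (E : ℝ) (v : n → ℂ) : ℝ :=
  2 * (star v ⬝ᵥ (reducedResolvent K E *ᵥ v)).re

/-- Unfolding lemma for `staticSusceptibility`. [folklore] -/
theorem staticSusceptibility_def (K : Matrix n n ℂ) (E : ℝ) (v : n → ℂ) :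
    staticSusceptibility K E v = 2 * (star v ⬝ᵥ (reducedResolvent K E *ᵥ v)).re :=
  rfl

/-- No transition vector, no response. [folklore] -/
@[simp] theorem staticSusceptibility_zero_right (K : Matrix n n ℂ) (E : ℝ) :
    staticSusceptibility K E 0 = 0 := by
  simp [staticSusceptibility]

/-- The susceptibility is a quadratic form in the transition vector: `χ(c v) = ‖c‖² χ(v)`.
[folklore] -/
theorem staticSusceptibility_smul (K : Matrix n n ℂ) (E : ℝ) (c : ℂ) (v : n → ℂ) :
    staticSusceptibility K E (c • v) = ‖c‖ ^ 2 * staticSusceptibility K E v := by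
  simp only [staticSusceptibility, mulVec_smul, star_smul, smul_dotProduct, dotProduct_smul,
    smul_eq_mul]
  rw [← mul_assoc, Complex.star_def, Complex.mul_conj', ← Complex.ofReal_pow,
    Complex.re_ofReal_mul]
  ring

omit [DecidableEq n] in
/-- `⟨x, M y⟩ = ⟨Mᴴ x, y⟩` in the `dotProduct` language (`star x ⬝ᵥ M y = star (Mᴴ x) ⬝ᵥ y`).
[folklore] -/
theorem star_dotProduct_mulVec (M : Matrix n n ℂ) (x y : n → ℂ) :
    star x ⬝ᵥ (M *ᵥ y) = star (Mᴴ *ᵥ x) ⬝ᵥ y := by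
  rw [dotProduct_mulVec, star_mulVec, conjTranspose_conjTranspose]

/-- The quadratic form of a unitarily conjugated diagonal matrix:
`⟨v, U diag(d) U⋆ v⟩ = Σ_i d_i |(U⋆ v)_i|²`. [folklore] -/
theorem star_dotProduct_conj_diagonal_mulVec (U : Matrix n n ℂ) (d v : n → ℂ) :
    star v ⬝ᵥ ((U * diagonal d * star U) *ᵥ v) =
      ∑ i, d i * (star ((star U *ᵥ v) i) * (star U *ᵥ v) i) := by
  have hw : star v ᵥ* U = star (star U *ᵥ v) := by
    rw [star_mulVec, star_eq_conjTranspose, conjTranspose_conjTranspose]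
  rw [← mulVec_mulVec, ← mulVec_mulVec, dotProduct_mulVec, hw]
  simp only [dotProduct, Pi.star_apply, mulVec_diagonal]
  exact Finset.sum_congr rfl fun i _ => by ring

/-- Coordinates in Mathlib's eigenbasis: `(U⋆ v)_i = ⟨u_i, v⟩` for the eigenvector unitary `U`
(columns `u_i = eigenvectorBasis i`) of a Hermitian matrix. [folklore] -/
theorem star_eigenvectorUnitary_mulVec_apply {K : Matrix n n ℂ} (hK : K.IsHermitian)
    (v : n → ℂ) (i : n) :
    (star (hK.eigenvectorUnitary : Matrix n n ℂ) *ᵥ v) i = star ⇑(hK.eigenvectorBasis i) ⬝ᵥ v := by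
  simp only [mulVec, dotProduct, Matrix.star_apply, IsHermitian.eigenvectorUnitary_apply,
    Pi.star_apply]

/-- **The static susceptibility as a spectral sum** ("sum over intermediate states"): for a
Hermitian `K` with Mathlib's orthonormal eigenbasis `(u_m, λ_m)`,
`χ_K(E; v) = 2 Σ_m |⟨u_m, v⟩|² / (λ_m − E)`, the terms with `λ_m = E` being omitted (Lean:
`x / 0 = 0`, the reduced-resolvent convention `S P = 0`). This is Kato's (2.35) form of the
second-order coefficient (Kato 1966, II-§2.2 Remark 2.2), up to the factor `−2`.
[cite: Kato1966, II-§2.2 (2.35)] -/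
theorem staticSusceptibility_eq_sum {K : Matrix n n ℂ} (hK : K.IsHermitian) (E : ℝ) (v : n → ℂ) :
    staticSusceptibility K E v =
      2 * ∑ i, ‖star ⇑(hK.eigenvectorBasis i) ⬝ᵥ v‖ ^ 2 / (hK.eigenvalues i - E) := by
  rw [staticSusceptibility, reducedResolvent, hK.cfc_eq_conj_diagonal,
    star_dotProduct_conj_diagonal_mulVec]
  congr 1
  have hterm : ∀ i, (((fun x : ℝ => (x - E)⁻¹) (hK.eigenvalues i) : ℝ) : ℂ) *
      (star ((star (hK.eigenvectorUnitary : Matrix n n ℂ) *ᵥ v) i) *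
        (star (hK.eigenvectorUnitary : Matrix n n ℂ) *ᵥ v) i) =
      ((‖star ⇑(hK.eigenvectorBasis i) ⬝ᵥ v‖ ^ 2 / (hK.eigenvalues i - E) : ℝ) : ℂ) := by
    intro i
    rw [star_eigenvectorUnitary_mulVec_apply, Complex.star_def, Complex.conj_mul']
    push_cast
    ring
  simp only [hterm, ← Complex.ofReal_sum, Complex.ofReal_re]

/-- **Nonnegativity.** If the transition vector only meets eigenvectors with eigenvalue `≥ E`
(e.g. `E` at or below the bottom of the spectrum of `K` on an invariant subspace containing `v`),
every term of the spectral sum is `≥ 0`, hence so is the susceptibility (second-order perturbation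
theory lowers the lowest level: `λ̂⁽²⁾ ≤ 0`). [folklore] -/
theorem staticSusceptibility_nonneg {K : Matrix n n ℂ} (hK : K.IsHermitian) {E : ℝ} {v : n → ℂ}
    (h : ∀ i, E ≤ hK.eigenvalues i ∨ star ⇑(hK.eigenvectorBasis i) ⬝ᵥ v = 0) :
    0 ≤ staticSusceptibility K E v := by
  rw [staticSusceptibility_eq_sum hK]
  refine mul_nonneg zero_le_two (Finset.sum_nonneg fun i _ => ?_)
  rcases h i with h | h
  · exact div_nonneg (sq_nonneg _) (sub_nonneg.2 h)
  · simp [h]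

/-- **The functional calculus on an eigenvector**: if `K ψ = μ ψ` for a Hermitian matrix `K` and a
real `μ`, then `f(K) ψ = f(μ) ψ` for every real function `f` (finite spectrum: `cfc` acts on bare
functions). [folklore] -/
theorem _root_.Matrix.IsHermitian.cfc_mulVec_of_eigenvector {K : Matrix n n ℂ} (hK : K.IsHermitian)
    (f : ℝ → ℝ) {μ : ℝ} {ψ : n → ℂ} (hψ : K *ᵥ ψ = (μ : ℂ) • ψ) :
    cfc f K *ᵥ ψ = ((f μ : ℝ) : ℂ) • ψ := by
  have hUu : (hK.eigenvectorUnitary : Matrix n n ℂ) ∈ unitary (Matrix n n ℂ) :=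
    hK.eigenvectorUnitary.prop
  -- `ψ = U (U⋆ ψ)`
  have hψU : (hK.eigenvectorUnitary : Matrix n n ℂ) *ᵥ
      (star (hK.eigenvectorUnitary : Matrix n n ℂ) *ᵥ ψ) = ψ := by
    rw [mulVec_mulVec, Unitary.mul_star_self_of_mem hUu, one_mulVec]
  -- in eigen-coordinates the eigenvalue equation reads `λ_i w_i = μ w_i`
  have hdiag : diagonal (fun i => (hK.eigenvalues i : ℂ)) *ᵥ
      (star (hK.eigenvectorUnitary : Matrix n n ℂ) *ᵥ ψ) =
        (μ : ℂ) • (star (hK.eigenvectorUnitary : Matrix n n ℂ) *ᵥ ψ) := by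
    rw [← hK.star_mul_self_mul_eq_diagonal, ← mulVec_mulVec, ← mulVec_mulVec, hψU, hψ,
      mulVec_smul]
  have hcoord : ∀ i, hK.eigenvalues i = μ ∨
      (star (hK.eigenvectorUnitary : Matrix n n ℂ) *ᵥ ψ) i = 0 := by
    intro i
    have hi := congrFun hdiag i
    rw [mulVec_diagonal, Pi.smul_apply, smul_eq_mul, ← sub_eq_zero, ← sub_mul] at hi
    rcases mul_eq_zero.1 hi with h | h
    · exact Or.inl (by exact_mod_cast sub_eq_zero.1 h)
    · exact Or.inr h
  calc cfc f K *ᵥ ψ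
      = (hK.eigenvectorUnitary : Matrix n n ℂ) *ᵥ
          (diagonal (fun i => ((f (hK.eigenvalues i) : ℝ) : ℂ)) *ᵥ
            (star (hK.eigenvectorUnitary : Matrix n n ℂ) *ᵥ ψ)) := by
        rw [hK.cfc_eq_conj_diagonal, ← mulVec_mulVec, ← mulVec_mulVec]
    _ = (hK.eigenvectorUnitary : Matrix n n ℂ) *ᵥ
          (((f μ : ℝ) : ℂ) • (star (hK.eigenvectorUnitary : Matrix n n ℂ) *ᵥ ψ)) := by
        congr 1
        funext i
        rw [mulVec_diagonal, Pi.smul_apply, smul_eq_mul]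
        rcases hcoord i with h | h
        · rw [h]
        · rw [h, mul_zero, mul_zero]
    _ = ((f μ : ℝ) : ℂ) • ψ := by rw [mulVec_smul, hψU]

/-- The reduced resolvent annihilates its own eigenvectors: `K ψ = E ψ ⇒ S_K(E) ψ = 0`
(Kato's `S P = 0`, Kato 1966, I-(5.28), on vectors). [cite: Kato1966, I-§5.3 (5.28)] -/
theorem reducedResolvent_mulVec_of_eigenvector {K : Matrix n n ℂ} (hK : K.IsHermitian) {E : ℝ}
    {ψ : n → ℂ} (hψ : K *ᵥ ψ = (E : ℂ) • ψ) : reducedResolvent K E *ᵥ ψ = 0 := by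
  rw [reducedResolvent, hK.cfc_mulVec_of_eigenvector _ hψ]
  simp

/-- The eigenprojection fixes the eigenvectors: `K ψ = E ψ ⇒ P ψ = ψ` (Kato 1966, I-§5.3).
[cite: Kato1966, I-§5.3 (5.26)] -/
theorem eigenProj_mulVec_of_eigenvector {K : Matrix n n ℂ} (hK : K.IsHermitian) {E : ℝ}
    {ψ : n → ℂ} (hψ : K *ᵥ ψ = (E : ℂ) • ψ) : eigenProj K E *ᵥ ψ = ψ := by
  rw [eigenProj, hK.cfc_mulVec_of_eigenvector _ hψ, if_pos rfl, Complex.ofReal_one, one_smul]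

/-- **Link with Kato's second-order reduced operator.** For a Hermitian `K`, a Hermitian
perturbation direction `B` and an eigenvector `K ψ = E ψ`, the static susceptibility in the
transition direction `B ψ` is `−2 Re ⟨ψ, T̃⁽²⁾ ψ⟩` with
`T̃⁽²⁾ = secondOrderEffective K B E = −P B S B P` the second-order effective operator of the
family `K − h B` on the `E`-eigenspace (Kato 1966, II-§2.2 (2.20); for a simple eigenvalue
`⟨ψ, T̃⁽²⁾ ψ⟩ = λ̂⁽²⁾` of (2.33), so `χ = −2 λ̂⁽²⁾ = −d²λ/dh²|₀`). [cite: Kato1966, II-§2.2 (2.20), (2.33)] -/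
theorem staticSusceptibility_mulVec_eq_secondOrderEffective {K B : Matrix n n ℂ}
    (hK : K.IsHermitian) (hB : B.IsHermitian) {E : ℝ} {ψ : n → ℂ} (hψ : K *ᵥ ψ = (E : ℂ) • ψ) :
    staticSusceptibility K E (B *ᵥ ψ) =
      -2 * (star ψ ⬝ᵥ (secondOrderEffective K B E *ᵥ ψ)).re := by
  have hP := eigenProj_mulVec_of_eigenvector hK hψ
  have h1 : (eigenProj K E * B * reducedResolvent K E * B * eigenProj K E) *ᵥ ψ =
      eigenProj K E *ᵥ (B *ᵥ (reducedResolvent K E *ᵥ (B *ᵥ ψ))) := by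
    simp only [← mulVec_mulVec, hP]
  have h2 : star ψ ⬝ᵥ (eigenProj K E *ᵥ (B *ᵥ (reducedResolvent K E *ᵥ (B *ᵥ ψ)))) =
      star (B *ᵥ ψ) ⬝ᵥ (reducedResolvent K E *ᵥ (B *ᵥ ψ)) := by
    rw [star_dotProduct_mulVec (eigenProj K E), (eigenProj_isHermitian K E).eq, hP,
      star_dotProduct_mulVec B, hB.eq]
  rw [staticSusceptibility, secondOrderEffective, neg_mulVec, dotProduct_neg, Complex.neg_re, h1, h2]
  ring

end Static

/-! ### Canonical bookkeeping: the midpoint pair chemical potential and the pair gap -/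

section Hubbard

variable {Λ : Type*} [LinearOrder Λ] [Fintype Λ]

/-- The **midpoint pair chemical potential** of the `N`-particle problem,
`μ̄ = ¼ [E₀(N+2) − E₀(N−2)]` with `E₀(M) = Matrix.minEnergyOn H (szSector M 0)` the ground-state
energy of `H` in the sector `(M, S^z = 0)`: the chemical potential at which the lowest
`(N+2)`- and `(N−2)`-particle intermediate states of a pair operator are degenerate in `H − μ̄ N̂`
(Lin–Hirsch–Scalapino 1988, eq. (9)). Junk for `N < 2` (truncated subtraction).
[cite: LinHirschScalapino1988, §II eq. (9)] -/
def pairChemicalPotential (H : Matrix (Finset (Orb Λ)) (Finset (Orb Λ)) ℂ) (N : ℕ) : ℝ :=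
  (H.minEnergyOn (szSector (N + 2) 0) - H.minEnergyOn (szSector (N - 2) 0)) / 4

/-- Unfolding lemma for `pairChemicalPotential`. [cite: LinHirschScalapino1988, §II eq. (9)] -/
theorem pairChemicalPotential_def (H : Matrix (Finset (Orb Λ)) (Finset (Orb Λ)) ℂ) (N : ℕ) :
    pairChemicalPotential H N =
      (H.minEnergyOn (szSector (N + 2) 0) - H.minEnergyOn (szSector (N - 2) 0)) / 4 :=
  rfl

/-- The **pair excitation gap** `Δ = ½ [E₀(N+2) + E₀(N−2) − 2E₀(N)]` of the `N`-particle problem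
(sector energies at `S^z = 0`): the common excitation energy, in `K = H − μ̄ N̂`, of the lowest
`(N±2)`-particle states above the `N`-particle ground state (Lin–Hirsch–Scalapino 1988, the display
after eq. (9): `Δ = E₀(N_e+2) − E₀(N_e) − 2μ = E₀(N_e−2) − E₀(N_e) + 2μ`; see
`minEnergyOn_add_two_sub_eq_pairGap`, `minEnergyOn_sub_two_sub_eq_pairGap`). Junk for `N < 2`.
[cite: LinHirschScalapino1988, §II eq. (9)] -/
def pairGap (H : Matrix (Finset (Orb Λ)) (Finset (Orb Λ)) ℂ) (N : ℕ) : ℝ :=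
  (H.minEnergyOn (szSector (N + 2) 0) + H.minEnergyOn (szSector (N - 2) 0) -
    2 * H.minEnergyOn (szSector N 0)) / 2

/-- `E₀(N+2) − E₀(N) − 2μ̄ = Δ` (Lin–Hirsch–Scalapino 1988, after eq. (9)).
[cite: LinHirschScalapino1988, §II eq. (9)] -/
theorem minEnergyOn_add_two_sub_eq_pairGap (H : Matrix (Finset (Orb Λ)) (Finset (Orb Λ)) ℂ)
    (N : ℕ) :
    H.minEnergyOn (szSector (N + 2) 0) - H.minEnergyOn (szSector N 0) -
        2 * pairChemicalPotential H N = pairGap H N := by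
  unfold pairChemicalPotential pairGap
  ring

/-- `E₀(N−2) − E₀(N) + 2μ̄ = Δ` (Lin–Hirsch–Scalapino 1988, after eq. (9)).
[cite: LinHirschScalapino1988, §II eq. (9)] -/
theorem minEnergyOn_sub_two_sub_eq_pairGap (H : Matrix (Finset (Orb Λ)) (Finset (Orb Λ)) ℂ)
    (N : ℕ) :
    H.minEnergyOn (szSector (N - 2) 0) - H.minEnergyOn (szSector N 0) +
        2 * pairChemicalPotential H N = pairGap H N := by
  unfold pairChemicalPotential pairGap
  ring

/-- `H − μ N̂` is Hermitian for Hermitian `H` and real `μ`. [folklore] -/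
theorem isHermitian_sub_smul_totalNumber {H : Matrix (Finset (Orb Λ)) (Finset (Orb Λ)) ℂ}
    (hH : H.IsHermitian) (μ : ℝ) :
    (H - (μ : ℂ) • (totalNumber : Matrix (Finset (Orb Λ)) (Finset (Orb Λ)) ℂ)).IsHermitian := by
  refine hH.sub ?_
  rw [IsHermitian, conjTranspose_smul, totalNumber_isHermitian.eq, Complex.star_def,
    Complex.conj_ofReal]

/-- A ground state `ψ` of `H` in the sector `(N, S^z = 0)` is an eigenvector of `K = H − μ N̂`
with eigenvalue `E₀(N) − μ N`, for every real `μ` (no commutation hypothesis: `N̂ ψ = N ψ` on the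
sector and `H ψ = E₀(N) ψ` by definition of `IsGroundStateInSector`). [folklore] -/
theorem sub_smul_totalNumber_mulVec_of_isGroundStateInSector
    {H : Matrix (Finset (Orb Λ)) (Finset (Orb Λ)) ℂ} {N : ℕ} {ψ : Fock (Orb Λ)}
    (hψ : IsGroundStateInSector H N 0 ψ) (μ : ℝ) :
    (H - (μ : ℂ) • (totalNumber : Matrix (Finset (Orb Λ)) (Finset (Orb Λ)) ℂ)) *ᵥ ψ =
      ((H.minEnergyOn (szSector N 0) - μ * N : ℝ) : ℂ) • ψ := by
  obtain ⟨hmem, -, hH⟩ := hψ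
  have hN : IsNParticle N ψ := ((mem_szSector_iff N 0 ψ).1 hmem).1
  rw [sub_mulVec, smul_mulVec, hH, totalNumber_mulVec_of_isNParticle hN, smul_smul,
    ← sub_smul]
  push_cast
  ring_nf

end Hubbard

/-! ### The pair susceptibility of the torus in a canonical sector -/

section Torus

variable {L : ℕ}

/-- The **zero-temperature pair susceptibility of the finite torus in a canonical sector**
(definition request `torusPairSusceptibility`). Data: a Hamiltonian `H` on the Fock space of the
fermionic torus `(ℤ/Lℤ)²` (intended: Hermitian, commuting with `N̂` and `S^z`, e.g.
`hubbardTorus 2 L t U`), a pair operator `A` (intended: lowering the particle number by two at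
fixed `S^z`, e.g. the `d`-wave pair field `pairField dWaveFormFactor L`), a particle number `N`
and a state `ψ` (intended: a normalised ground state of `H` in `szSector N 0`). Value:
`χ_A(ψ) = 2 Re ⟨(A + Aᴴ)ψ, S_K(E) (A + Aᴴ)ψ⟩ = 2 Σ_m |⟨m, (A + Aᴴ)ψ⟩|² / (E^K_m − E)`
(`torusPairSusceptibility_eq_sum`; sum over an orthonormal eigenbasis of `K`, terms with
`E^K_m = E` omitted), where `K = H − μ̄ N̂`, `μ̄ = pairChemicalPotential H N = ¼[E₀(N+2) − E₀(N−2)]`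
is the midpoint pair chemical potential of Lin–Hirsch–Scalapino 1988, eq. (9), and
`E = E₀(N) − μ̄ N` the `K`-energy of the sector ground states. Under the intended hypotheses only
intermediate states `m` in `szSector (N−2) 0 ⊕ szSector (N+2) 0` occur, with denominators
`(ε_m − E₀(N∓2)) + pairGap H N` (`ε_m` the `H`-eigenvalue): twice the sum of the zero-frequency
`T = 0` particle–particle and hole–hole pair propagators `Σ_{m ∈ (N+2)} |⟨m, Aᴴψ⟩|²/(E^K_m − E)`,
`Σ_{m ∈ (N−2)} |⟨m, Aψ⟩|²/(E^K_m − E)` of the sector ground state — the `T = 0`, fixed-`N`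
counterpart of the pair-field susceptibility `P = ∫₀^β ⟨Δ(τ)Δ†(0)⟩ dτ` of Lin–Hirsch–Scalapino
1988, eq. (8) (midpoint chemical potential of eq. (9)), White et al. 1989 and Scalapino 1995 §4
(`P_d`) — and, for a normalised `ψ` spanning the `E`-eigenspace of `K`, `−d²λ/dh²|₀` of the
eigenvalue branch `λ(h)` of `K − h(A + Aᴴ)` through `E` (Kato 1966, II-(2.33);
`torusPairSusceptibility_eq_of_isGroundStateInSector` gives the algebraic form
`−2 Re ⟨ψ, T̃⁽²⁾ ψ⟩` for every sector ground state). [cite: LinHirschScalapino1988, §II eq. (8)–(9)] -/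
def torusPairSusceptibility
    (H A : Matrix (Finset (Orb (FermionTorus 2 L))) (Finset (Orb (FermionTorus 2 L))) ℂ) (N : ℕ)
    (ψ : Fock (Orb (FermionTorus 2 L))) : ℝ :=
  staticSusceptibility (H - (pairChemicalPotential H N : ℂ) • totalNumber)
    (H.minEnergyOn (szSector N 0) - pairChemicalPotential H N * N) ((A + Aᴴ) *ᵥ ψ)

variable (H A : Matrix (Finset (Orb (FermionTorus 2 L))) (Finset (Orb (FermionTorus 2 L))) ℂ)
  (N : ℕ) (ψ : Fock (Orb (FermionTorus 2 L)))

/-- Unfolding lemma: `χ_A(ψ) = staticSusceptibility K E ((A + Aᴴ)ψ)` with `K = H − μ̄ N̂`,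
`E = E₀(N) − μ̄ N`. [cite: LinHirschScalapino1988, §II eq. (8)–(9)] -/
theorem torusPairSusceptibility_eq :
    torusPairSusceptibility H A N ψ =
      staticSusceptibility (H - (pairChemicalPotential H N : ℂ) • totalNumber)
        (H.minEnergyOn (szSector N 0) - pairChemicalPotential H N * N) ((A + Aᴴ) *ᵥ ψ) :=
  rfl

/-- The resolvent form written out: `χ_A(ψ) = 2 Re ⟨(A + Aᴴ)ψ, S_K(E) (A + Aᴴ)ψ⟩`.
[cite: Kato1966, I-§5.3 (5.32)] -/
theorem torusPairSusceptibility_eq_re :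
    torusPairSusceptibility H A N ψ =
      2 * (star ((A + Aᴴ) *ᵥ ψ) ⬝ᵥ
        (reducedResolvent (H - (pairChemicalPotential H N : ℂ) • totalNumber)
            (H.minEnergyOn (szSector N 0) - pairChemicalPotential H N * N) *ᵥ
          ((A + Aᴴ) *ᵥ ψ))).re :=
  rfl

/-- Phase and normalisation bookkeeping: `χ_A(c ψ) = ‖c‖² χ_A(ψ)` (so the value on a normalised
ground state does not depend on its phase). [folklore] -/
theorem torusPairSusceptibility_smul (c : ℂ) :
    torusPairSusceptibility H A N (c • ψ) = ‖c‖ ^ 2 * torusPairSusceptibility H A N ψ := by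
  rw [torusPairSusceptibility, mulVec_smul, staticSusceptibility_smul, torusPairSusceptibility]

variable {H N}

/-- **The defining spectral sum.** If `K = H − μ̄ N̂` is Hermitian (e.g. `H` Hermitian,
`isHermitian_sub_smul_totalNumber`), then over Mathlib's orthonormal eigenbasis `(u_m, E^K_m)` of
`K`: `χ_A(ψ) = 2 Σ_m |⟨u_m, (A + Aᴴ)ψ⟩|² / (E^K_m − E)`, `E = E₀(N) − μ̄ N`, the terms with
`E^K_m = E` omitted (`x / 0 = 0`) — the formula of the definition request (Lin–Hirsch–Scalapino
1988, eq. (8)–(9) at `β → ∞`; Kato 1966, II-(2.35)). [cite: Kato1966, II-§2.2 (2.35)] -/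
theorem torusPairSusceptibility_eq_sum
    (hK : (H - (pairChemicalPotential H N : ℂ) •
      (totalNumber : Matrix (Finset (Orb (FermionTorus 2 L))) _ ℂ)).IsHermitian) :
    torusPairSusceptibility H A N ψ =
      2 * ∑ m, ‖star ⇑(hK.eigenvectorBasis m) ⬝ᵥ ((A + Aᴴ) *ᵥ ψ)‖ ^ 2 /
        (hK.eigenvalues m - (H.minEnergyOn (szSector N 0) - pairChemicalPotential H N * N)) :=
  staticSusceptibility_eq_sum hK _ _

/-- **Nonnegativity.** If the transition vector `(A + Aᴴ)ψ` only meets eigenvectors of `K` with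
`E^K_m ≥ E` (the case when `H` conserves the sectors, `(A + Aᴴ)ψ ∈ szSector (N−2) 0 ⊕
szSector (N+2) 0` and `pairGap H N ≥ 0`), then `χ_A(ψ) ≥ 0`. [folklore] -/
theorem torusPairSusceptibility_nonneg
    (hK : (H - (pairChemicalPotential H N : ℂ) •
      (totalNumber : Matrix (Finset (Orb (FermionTorus 2 L))) _ ℂ)).IsHermitian)
    (h : ∀ m, H.minEnergyOn (szSector N 0) - pairChemicalPotential H N * N ≤ hK.eigenvalues m ∨
      star ⇑(hK.eigenvectorBasis m) ⬝ᵥ ((A + Aᴴ) *ᵥ ψ) = 0) :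
    0 ≤ torusPairSusceptibility H A N ψ :=
  staticSusceptibility_nonneg hK h

/-- **Second-order perturbation theory.** For a Hermitian `H` and ANY ground state `ψ` of `H` in
the sector `(N, S^z = 0)`: `χ_A(ψ) = −2 Re ⟨ψ, T̃⁽²⁾ ψ⟩`, where
`T̃⁽²⁾ = secondOrderEffective K (A + Aᴴ) E = −P (A + Aᴴ) S_K(E) (A + Aᴴ) P` is Kato's second-order
reduced operator of the family `K − h (A + Aᴴ)` on the `E`-eigenspace of `K = H − μ̄ N̂`
(Kato 1966, II-§2.2 (2.20), (2.33): for a simple eigenvalue this is `−d²λ/dh²|_{h=0}`; in general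
the branches' second-order coefficients are the eigenvalues of `T̃⁽²⁾` on the eigenspace,
II-§2.3). [cite: Kato1966, II-§2.2 (2.33)] -/
theorem torusPairSusceptibility_eq_of_isGroundStateInSector (hH : H.IsHermitian)
    (hψ : IsGroundStateInSector H N 0 ψ) :
    torusPairSusceptibility H A N ψ =
      -2 * (star ψ ⬝ᵥ (secondOrderEffective (H - (pairChemicalPotential H N : ℂ) • totalNumber)
        (A + Aᴴ) (H.minEnergyOn (szSector N 0) - pairChemicalPotential H N * N) *ᵥ ψ)).re :=
  staticSusceptibility_mulVec_eq_secondOrderEffective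
    (isHermitian_sub_smul_totalNumber hH _) (isHermitian_add_transpose_self A)
    (sub_smul_totalNumber_mulVec_of_isGroundStateInSector hψ _)

end Torus

end Literature.MathematicalPhysics.QuantumLattice
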